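import Literature.Computability.AlgebraicComplexity.SlidingWindowCounting
import Literature.Computability.AlgebraicComplexity.ZeroWindowShapes
import Literature.Computability.AlgebraicComplexity.ProjectedShiftedPartialsPairs
import HarnessLib

/-!
# The measure of the restricted sliding-window polynomial is large

Topic `Literature/Computability/AlgebraicComplexity`; sequel of `SlidingWindowCounting.lean` and
`ZeroWindowShapes.lean`, part of the discharge of
`Literature.Barriers.ValiantsHypothesis.DepthReductionChasmDepthFour` (Kumar–Saraf 2017,
Cor. 1.3). We feed the pair-count lower bound `KumarSaraf.sum_card_support_mul_choose_le`
(`ProjectedShiftedPartialsPairs.lean`, the deterministic core of Kumar–Saraf's Lemma 8.9) with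
the derivatives `∂_{wv}` of `P = swPoly|_{selVars g}`:

* `choose_sub_le_pow_mul`, `choose_sub_sub_le_pow_mul` — the binomial ratio estimates
  `C(A-Δ, m) ≤ ((A-m)/A)^Δ C(A, m)` and `C(A-Δ, m-Δ) ≤ (m/A)^Δ C(A, m)` behind Kumar–Saraf's
  approximations `≈ (m/(N-m))^{…}` (Lemma 3.6 as used in §8.8);
* `pspDim_restrict_ge` — for ANY injective site map:
  `2^{n+t} · C(N-b, m) ≤ Φ_{𝒯,m}(P) · E² · Λ` with `b = n - r`, `x = (N-b-m)/(N-b)`,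
  `E = ∑_{u ∈ Zset 0} x^{b - nsZero u}` and `Λ = ∑_u (1-x)^{b - nsZero u}`;
* `E_eq_of_siteOf`, `Λ_le` — for the equally spaced sites `siteOf d` these are the shaped sum
  `x^n · V_{x⁻¹}(d, r, n+t)` (`ZeroWindowShapes.lean`) and at most `(1-x)^b · F_{(1-x)⁻¹}(n+t)`.

## References

* M. Kumar, S. Saraf, *On the power of homogeneous depth 4 arithmetic circuits*, SIAM J. Comput.
  46 (2017) 336–387: Lemma 3.6, §8.5–§8.8 (Lemmas 8.3–8.9, Thm. 8.10).
-/

noncomputable section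

open MvPolynomial

namespace Literature.Computability.AlgebraicComplexity

namespace SlidingWindow

open KumarSaraf GKKS ZeroWindow Finset

/-! ### Binomial ratio estimates -/

/-- `C(A - Δ, m) ≤ ((A - m)/A)^Δ · C(A, m)` for `m + Δ ≤ A` (removing `Δ` elements from the
ground set costs a factor `≤ (A-m)/A` each). [cite: KumarSaraf2017, Lemma 3.6] -/
theorem choose_sub_le_pow_mul (A m : ℕ) : ∀ Δ : ℕ, m + Δ ≤ A →
    ((A - Δ).choose m : ℝ) ≤ (((A : ℝ) - m) / A) ^ Δ * A.choose m
  | 0, _ => by simp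
  | Δ + 1, h => by
    have ih := choose_sub_le_pow_mul A m Δ (by omega)
    have hA : (0 : ℝ) < A := by exact_mod_cast (show 0 < A by omega)
    have hid := Nat.choose_mul_succ_eq (A - (Δ + 1)) m
    rw [show A - (Δ + 1) + 1 = A - Δ by omega] at hid
    have hid' : (((A - (Δ + 1)).choose m : ℕ) : ℝ) * ((A : ℝ) - Δ) =
        (((A - Δ).choose m : ℕ) : ℝ) * ((A : ℝ) - Δ - m) := by
      have h1 : ((A - Δ : ℕ) : ℝ) = (A : ℝ) - Δ := Nat.cast_sub (by omega)
      have h2 : ((A - Δ - m : ℕ) : ℝ) = (A : ℝ) - Δ - m := by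
        rw [Nat.cast_sub (by omega), Nat.cast_sub (by omega)]
      rw [← h2, ← h1]
      exact_mod_cast hid
    have hu : (0 : ℝ) < (A : ℝ) - Δ := by
      have : ((Δ : ℕ) : ℝ) + 1 ≤ A := by exact_mod_cast (show Δ + 1 ≤ A by omega)
      linarith
    have hstep : (((A - (Δ + 1)).choose m : ℕ) : ℝ) ≤ (((A : ℝ) - m) / A) * (((A - Δ).choose m : ℕ) : ℝ) := by
      have hc0 : (0 : ℝ) ≤ (((A - Δ).choose m : ℕ) : ℝ) := Nat.cast_nonneg _
      have hratio : ((A : ℝ) - Δ - m) / ((A : ℝ) - Δ) ≤ ((A : ℝ) - m) / A := by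
        rw [div_le_div_iff₀ hu hA]
        have hm : (0 : ℝ) ≤ m := Nat.cast_nonneg _
        have hΔ : (0 : ℝ) ≤ Δ := Nat.cast_nonneg _
        nlinarith [mul_nonneg hm hΔ]
      have heq : (((A - (Δ + 1)).choose m : ℕ) : ℝ) = (((A - Δ).choose m : ℕ) : ℝ) * (((A : ℝ) - Δ - m) / ((A : ℝ) - Δ)) := by
        rw [mul_div_assoc', eq_div_iff hu.ne', hid']
      rw [heq, mul_comm (((A : ℝ) - m) / A)]
      exact mul_le_mul_of_nonneg_left hratio hc0
    calc (((A - (Δ + 1)).choose m : ℕ) : ℝ) ≤ (((A : ℝ) - m) / A) * (((A - Δ).choose m : ℕ) : ℝ) := hstep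
      _ ≤ (((A : ℝ) - m) / A) * ((((A : ℝ) - m) / A) ^ Δ * A.choose m) :=
          mul_le_mul_of_nonneg_left ih (div_nonneg (by
            have : ((m : ℕ) : ℝ) ≤ A := by exact_mod_cast (show m ≤ A by omega)
            linarith) hA.le)
      _ = _ := by rw [pow_succ]; ring

/-- `C(A - Δ, m - Δ) ≤ (m/A)^Δ · C(A, m)` for `Δ ≤ m ≤ A` (removing `Δ` elements from the ground
set and from the subset costs a factor `≤ m/A` each). [cite: KumarSaraf2017, Lemma 3.6] -/
theorem choose_sub_sub_le_pow_mul (A m : ℕ) (hmA : m ≤ A) : ∀ Δ : ℕ, Δ ≤ m →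
    ((A - Δ).choose (m - Δ) : ℝ) ≤ ((m : ℝ) / A) ^ Δ * A.choose m
  | 0, _ => by simp
  | Δ + 1, h => by
    have ih := choose_sub_sub_le_pow_mul A m hmA Δ (by omega)
    have hA : (0 : ℝ) < A := by exact_mod_cast (show 0 < A by omega)
    have hid := Nat.add_one_mul_choose_eq (A - (Δ + 1)) (m - (Δ + 1))
    rw [show A - (Δ + 1) + 1 = A - Δ by omega, show m - (Δ + 1) + 1 = m - Δ by omega] at hid
    have hid' : ((A : ℝ) - Δ) * (((A - (Δ + 1)).choose (m - (Δ + 1)) : ℕ) : ℝ) =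
        (((A - Δ).choose (m - Δ) : ℕ) : ℝ) * ((m : ℝ) - Δ) := by
      have h1 : ((A - Δ : ℕ) : ℝ) = (A : ℝ) - Δ := Nat.cast_sub (by omega)
      have h2 : ((m - Δ : ℕ) : ℝ) = (m : ℝ) - Δ := Nat.cast_sub (by omega)
      rw [← h1, ← h2]
      exact_mod_cast hid
    have hu : (0 : ℝ) < (A : ℝ) - Δ := by
      have : ((Δ : ℕ) : ℝ) + 1 ≤ A := by exact_mod_cast (show Δ + 1 ≤ A by omega)
      linarith
    have hstep : (((A - (Δ + 1)).choose (m - (Δ + 1)) : ℕ) : ℝ) ≤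
        ((m : ℝ) / A) * (((A - Δ).choose (m - Δ) : ℕ) : ℝ) := by
      have hc0 : (0 : ℝ) ≤ (((A - Δ).choose (m - Δ) : ℕ) : ℝ) := Nat.cast_nonneg _
      have hratio : ((m : ℝ) - Δ) / ((A : ℝ) - Δ) ≤ (m : ℝ) / A := by
        rw [div_le_div_iff₀ hu hA]
        have hm : ((m : ℕ) : ℝ) ≤ A := by exact_mod_cast hmA
        have hΔ : (0 : ℝ) ≤ Δ := Nat.cast_nonneg _
        nlinarith [mul_le_mul_of_nonneg_right hm hΔ]
      have heq : (((A - (Δ + 1)).choose (m - (Δ + 1)) : ℕ) : ℝ) =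
          (((A - Δ).choose (m - Δ) : ℕ) : ℝ) * (((m : ℝ) - Δ) / ((A : ℝ) - Δ)) := by
        rw [mul_div_assoc', eq_div_iff hu.ne', mul_comm, hid']
      rw [heq, mul_comm ((m : ℝ) / A)]
      exact mul_le_mul_of_nonneg_left hratio hc0
    calc (((A - (Δ + 1)).choose (m - (Δ + 1)) : ℕ) : ℝ) ≤
        ((m : ℝ) / A) * (((A - Δ).choose (m - Δ) : ℕ) : ℝ) := hstep
      _ ≤ ((m : ℝ) / A) * (((m : ℝ) / A) ^ Δ * A.choose m) :=
          mul_le_mul_of_nonneg_left ih (div_nonneg (Nat.cast_nonneg _) hA.le)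
      _ = _ := by rw [pow_succ]; ring

/-! ### The generic lower bound (any injective site map) -/

/-- The `T₂/T₁` bound `E(x) = ∑_{u ∈ Zset 0} x^{b - nsZero u}` (`b = n - r`), independent of the
derivative and of its monomial thanks to the XOR symmetry. [cite: KumarSaraf2017, §8.5] -/
def Esum {n r : ℕ} (t : ℕ) (site : Fin r → Fin n) (x : ℝ) : ℝ :=
  ∑ u ∈ Zset site (fun _ => zeroWin t), x ^ (n - r - nsZero site u)

/-- The `T₃/T₁` bound `Λ(x) = ∑_u (1-x)^{b - nsZero u}`. [cite: KumarSaraf2017, §8.5] -/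
def Lsum {n r : ℕ} (t : ℕ) (site : Fin r → Fin n) (x : ℝ) : ℝ :=
  ∑ u : List.Vector Bool (n + t), (1 - x) ^ (n - r - nsZero site u)

variable {n t B r : ℕ} {g : Fin n → Win t → Fin (B + 1)} {site : Fin r → Fin n} {K : Type*} [Field K]

/-- **The measure of `swPoly|_{selVars g}` is large** (Kumar–Saraf 2017, Lemma 8.9 for the
sliding-window witness, deterministic): for `0 < n`, an injective site map, any monomial order,
and a shift degree `m` with `b ≤ m`, `m + b ≤ N - b` (`b = n - r`, `N` the number of variables),
`2^{n+t} · C(N-b, m) ≤ Φ_{𝒯,m}(swPoly|_{selVars g}) · E(x)² · Λ(x)`, `x = ((N-b)-m)/(N-b)`.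
[cite: KumarSaraf2017, Lemma 8.9] -/
theorem pspDim_restrict_ge (hn : 0 < n) (hsite : Function.Injective site)
    (mo : MonomialOrder (Var n t B)) (m : ℕ) (hbm : n - r ≤ m)
    (hm : m + (n - r) ≤ Fintype.card (Var n t B) - (n - r))
    (hNb : n - r < Fintype.card (Var n t B)) :
    (2 : ℝ) ^ (n + t) * ((Fintype.card (Var n t B) - (n - r)).choose m : ℕ) ≤
      (pspDim (Ls g site) m (restrictVars (selVars g) (swPoly K n t B)) : ℝ) *
        Esum t site ((((Fintype.card (Var n t B) - (n - r) : ℕ) : ℝ) - m) /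
          ((Fintype.card (Var n t B) - (n - r) : ℕ) : ℝ)) ^ 2 *
        Lsum t site ((((Fintype.card (Var n t B) - (n - r) : ℕ) : ℝ) - m) /
          ((Fintype.card (Var n t B) - (n - r) : ℕ) : ℝ)) := by
  classical
  set N := Fintype.card (Var n t B) with hN
  set b := n - r with hb
  set A := N - b with hA
  set x : ℝ := (((A : ℕ) : ℝ) - m) / ((A : ℕ) : ℝ) with hx
  set f := restrictVars (selVars g) (swPoly K n t B) with hf
  have hA0 : (0 : ℝ) < A := by exact_mod_cast (show 0 < A by omega)
  have hmA : ((m : ℕ) : ℝ) ≤ A := by exact_mod_cast (show m ≤ A by omega)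
  have hx0 : 0 ≤ x := div_nonneg (by linarith) hA0.le
  have hx1 : x ≤ 1 := by rw [hx, div_le_one hA0]; linarith [(Nat.cast_nonneg m : (0:ℝ) ≤ m)]
  have h1x : 1 - x = (m : ℝ) / A := by
    rw [hx, eq_div_iff hA0.ne', sub_mul, div_mul_cancel₀ _ hA0.ne']; ring
  -- supports of the derivatives
  have hsupp := fun wv => support_iterPderiv_restrict (g := g) (K := K) hsite hn wv
  have hinj : ∀ wv, Set.InjOn (fun z => chi (nsVars g site z)) (Zset site wv : Set _) :=
    fun wv z hz z' hz' h => nsVars_injOn hn wv hz hz' (chi_injective h)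
  have hE0 : 0 ≤ Esum t site x := Finset.sum_nonneg fun _ _ => pow_nonneg hx0 _
  have hΛ0 : 0 ≤ Lsum t site x := Finset.sum_nonneg fun _ _ => pow_nonneg (by linarith) _
  have key := sum_card_support_mul_choose_le mo (Ls g site) m b f
    (fun wv β hβ => isML_of_mem_support hsite hn wv hβ)
    (fun wv β hβ => card_support_of_mem_support hsite hn wv hβ) hE0 hΛ0 ?_ ?_
  · rw [sum_card_support hsite hn] at key
    push_cast at key
    exact key
  · -- `T₂`: pairs from the same derivative
    intro wv β hβ
    rw [hf, hsupp wv, Finset.mem_image] at hβ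
    obtain ⟨z, hz, rfl⟩ := hβ
    rw [hf, hsupp wv, Finset.sum_image (hinj wv)]
    calc ∑ z' ∈ Zset site wv, ((N - ((chi (nsVars g site z)).support ∪
          (chi (nsVars g site z')).support).card).choose m : ℝ)
        = ∑ z' ∈ Zset site wv, ((A - (b - agr site z z')).choose m : ℝ) := by
          refine Finset.sum_congr rfl fun z' _ => ?_
          rw [support_chi, support_chi, card_union_nsVars hsite]
          congr 2
          have := agr_le (site := site) z z'
          rw [card_nonSites hsite] at this
          omega
      _ ≤ ∑ z' ∈ Zset site wv, x ^ (b - agr site z z') * (A.choose m : ℝ) :=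
          Finset.sum_le_sum fun z' _ => choose_sub_le_pow_mul A m _ (by
            have := agr_le (site := site) z z'; rw [card_nonSites hsite] at this; omega)
      _ = Esum t site x * (A.choose m : ℝ) := by
          rw [← Finset.sum_mul, Esum, sum_Zset_agr_eq site (fun k => x ^ (b - k)) hz]
  · -- `T₃`: pairs from arbitrary derivatives
    intro wv β hβ
    rw [hf, hsupp wv, Finset.mem_image] at hβ
    obtain ⟨z, hz, rfl⟩ := hβ
    have step : ∀ wv', ∑ β' ∈ (iterPderiv (Ls g site wv') f).support,
        ((N - ((chi (nsVars g site z)).support ∪ β'.support).card).choose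
          (m - (β'.support \ (chi (nsVars g site z)).support).card) : ℝ) ≤
        ∑ z' ∈ Zset site wv', (1 - x) ^ (b - agr site z z') * (A.choose m : ℝ) := by
      intro wv'
      rw [hf, hsupp wv', Finset.sum_image (hinj wv')]
      refine Finset.sum_le_sum fun z' _ => ?_
      rw [support_chi, support_chi, card_union_nsVars hsite, card_sdiff_nsVars hsite]
      have hagr := agr_le (site := site) z z'
      rw [card_nonSites hsite] at hagr
      rw [show N - (2 * (n - r) - agr site z z') = A - (b - agr site z z') by omega, h1x]
      exact choose_sub_sub_le_pow_mul A m (by omega) _ (by omega)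
    calc ∑ wv', ∑ β' ∈ (iterPderiv (Ls g site wv') f).support,
          ((N - ((chi (nsVars g site z)).support ∪ β'.support).card).choose
            (m - (β'.support \ (chi (nsVars g site z)).support).card) : ℝ)
        ≤ ∑ wv', ∑ z' ∈ Zset site wv', (1 - x) ^ (b - agr site z z') * (A.choose m : ℝ) :=
          Finset.sum_le_sum fun wv' _ => step wv'
      _ = Lsum t site x * (A.choose m : ℝ) := by
          rw [sum_sum_Zset_eq site (fun z' => (1 - x) ^ (b - agr site z z') * (A.choose m : ℝ)),
            ← Finset.sum_mul, sum_univ_agr_eq site (fun k => (1 - x) ^ (b - k))]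
          rfl

/-- `E(x) ≥ 0` for `x ≥ 0`. [folklore] -/
theorem Esum_nonneg {n r : ℕ} (t : ℕ) (site : Fin r → Fin n) {x : ℝ} (hx : 0 ≤ x) :
    0 ≤ Esum t site x :=
  Finset.sum_nonneg fun _ _ => pow_nonneg hx _

/-- `Λ(x) ≥ 0` for `x ≤ 1`. [folklore] -/
theorem Lsum_nonneg {n r : ℕ} (t : ℕ) (site : Fin r → Fin n) {x : ℝ} (hx : x ≤ 1) :
    0 ≤ Lsum t site x :=
  Finset.sum_nonneg fun _ _ => pow_nonneg (by linarith) _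

/-! ### The equally spaced sites and the closed forms of `E`, `Λ` -/

/-- **The sites** `d, 2d, …, r d` (as layers; requires `d r < n`). [cite: KumarSaraf2017, §8.4] -/
def siteOf {n r : ℕ} (d : ℕ) (hdr : d * r < n) (i : Fin r) : Fin n :=
  ⟨d * (i.val + 1), by
    have h1 : d * (i.val + 1) ≤ d * r := Nat.mul_le_mul_left d i.2
    omega⟩

/-- The sites are distinct for `d > 0`. [cite: KumarSaraf2017, §8.4] -/
theorem siteOf_injective {n r : ℕ} {d : ℕ} (hd : 0 < d) (hdr : d * r < n) :
    Function.Injective (siteOf (n := n) d hdr) := by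
  intro i j h
  have h1 : d * (i.val + 1) = d * (j.val + 1) := congrArg Fin.val h
  exact Fin.ext (by have := Nat.eq_of_mul_eq_mul_left hd h1; omega)

/-- Vanishing site windows is the shape `ShapeZ t d d r` of the underlying list. [folklore] -/
theorem mem_Zset_siteOf_zero_iff {n r : ℕ} {d : ℕ} (hdr : d * r < n) (u : List.Vector Bool (n + t)) :
    u ∈ Zset (siteOf d hdr) (fun _ => zeroWin t) ↔ ShapeZ t d d r u.toList := by
  rw [mem_Zset]
  constructor
  · intro h j hj
    have h1 := congrArg List.Vector.toList (h ⟨j, hj⟩)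
    rw [show d + j * d = d * (j + 1) by ring]
    exact h1
  · intro h i
    apply List.Vector.eq
    have h1 := h i.val i.2
    rw [show d + i.val * d = d * (i.val + 1) by ring] at h1
    exact h1

/-- **`E(x) = x^n · V_{x⁻¹}(d, r, n + t)`** for the equally spaced sites (`0 < d`, `0 < x`): all
zero windows of `u ∈ Zset 0` are the `r` site windows and the `nsZero u` others.
[cite: KumarSaraf2017, Lemma 8.3] -/
theorem Esum_siteOf_eq {n r : ℕ} {d : ℕ} (hd : 0 < d) (hdr : d * r < n) {x : ℝ} (hx : 0 < x) :
    Esum t (siteOf d hdr) x = x ^ n * V x⁻¹ t d d r (n + t) := by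
  classical
  unfold Esum V strSum
  rw [Finset.mul_sum]
  simp only [mul_ite, mul_zero]
  rw [← Finset.sum_filter]
  have hZ : Zset (siteOf d hdr) (fun _ => zeroWin t) =
      Finset.univ.filter (fun u : List.Vector Bool (n + t) => ShapeZ t d d r u.toList) := by
    ext u; rw [mem_Zset_siteOf_zero_iff, Finset.mem_filter]; simp
  rw [hZ]
  refine Finset.sum_congr rfl fun u hu => ?_
  have hu' : u ∈ Zset (siteOf d hdr) (fun _ => zeroWin t) := by rw [hZ]; exact hu
  have h1 := nsZero_add_eq_zwin (siteOf d hdr) (siteOf_injective hd hdr) hu'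
  have h2 : zwin t u.toList ≤ n := by
    have := zwin_le t u.toList; rw [u.toList_length] at this; omega
  rw [show n - r - nsZero (siteOf d hdr) u = n - zwin t u.toList by omega,
    pow_sub₀ x hx.ne' h2, inv_pow]

/-- **`Λ(x) ≤ (1-x)^{n-r} · F_{(1-x)⁻¹}(n + t)`** (`0 ≤ x < 1`): non-site zero windows are zero
windows. [cite: KumarSaraf2017, Lemma 8.5] -/
theorem Lsum_le {n r : ℕ} (site : Fin r → Fin n) {x : ℝ} (hx0 : 0 ≤ x) (hx1 : x < 1) :
    Lsum t site x ≤ (1 - x) ^ (n - r) * F (1 - x)⁻¹ t (n + t) := by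
  unfold Lsum F strSum
  rw [Finset.mul_sum]
  refine Finset.sum_le_sum fun u _ => ?_
  set c : ℝ := 1 - x with hc
  have hc0 : 0 < c := by rw [hc]; linarith
  have hc1 : c ≤ 1 := by rw [hc]; linarith
  have hθ : 1 ≤ c⁻¹ := one_le_inv₀ hc0 |>.2 hc1
  have hle := nsZero_le_zwin site u
  set ns := nsZero site u
  set zw := zwin t u.toList
  by_cases h : ns ≤ n - r
  · rw [pow_sub₀ c hc0.ne' h, ← inv_pow]
    exact mul_le_mul_of_nonneg_left (pow_le_pow_right₀ hθ hle) (pow_nonneg hc0.le _)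
  · push Not at h
    rw [Nat.sub_eq_zero_of_le h.le, pow_zero]
    calc (1 : ℝ) = c ^ (n - r) * (c⁻¹) ^ (n - r) := by
          rw [← mul_pow, mul_inv_cancel₀ hc0.ne', one_pow]
      _ ≤ c ^ (n - r) * (c⁻¹) ^ zw :=
          mul_le_mul_of_nonneg_left (pow_le_pow_right₀ hθ (by omega)) (pow_nonneg hc0.le _)

/-- The `i`-th site is layer `d (i + 1)`. [cite: KumarSaraf2017, §8.4] -/
@[simp] theorem siteOf_val {n r : ℕ} (d : ℕ) (hdr : d * r < n) (i : Fin r) :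
    (siteOf d hdr i).val = d * (i.val + 1) := rfl

/-- Distinct site indices give distinct layers (`0 < d`). [cite: KumarSaraf2017, §8.4] -/
theorem siteOf_ne {n r : ℕ} {d : ℕ} (hd : 0 < d) (hdr : d * r < n) {i j : Fin r} (h : i ≠ j) :
    siteOf d hdr i ≠ siteOf d hdr j :=
  fun he => h (siteOf_injective hd hdr he)

end SlidingWindow

end Literature.Computability.AlgebraicComplexity
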